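import Summits.BirchSwinnertonDyer.Rank1Residual.X11b.KolyvaginShaFiniteAtPrime
import Summits.BirchSwinnertonDyer.Rank1Residual.X11b.KolyvaginShaAnnihilatorAtPrime
import Summits.BirchSwinnertonDyer.Rank1Residual.X11b.KolyvaginLeafInputsDischarged
import Literature.NumberTheory.GaloisCohomology.PoitouTateNumberField
import HarnessLib

/-!
# `Ш(E/K)[p^∞]` at ONE odd surjective prime `p` on the Kodaira–Néron sub-class (KN_p)
# modulo ONE cite-only input `hγ`: finite, and killed by `p^{m}` when `p^{m+1} ∤ y_K`
# (the generic-prime X11b Kolyvagin ENDs with `hPT`, `hrec`, `hCM`, `h53` DISCHARGED)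

Cell `b2b-bsdres`, team x11b3 (N8/O2); seat x11b3-p2 GEN 52 (unit claimed D-0075 → BSD:K2/P4
«Kolyvagin-in-kernel»).  Summit-side THEOREM-ONLY file (no definition, no named fact, no `sorry`);
`K : Type`; ONE generic odd prime `p` with `ρ̄_{E,p}` onto.

HONEST FRAMING (cell `b2b-bsdres`, run/shared/lean/b2b/bsd-rank1-residual/, verbatim in every
file): the goal of the cell is to DELETE the COMBINATION-SHAPED residual classes of the
Birch–Swinnerton-Dyer formula for ALL analytic-rank `≤ 1` elliptic curves over `ℚ` — "full BSD
formula for every rank `≤ 1` curve in class `C`" assembled STRICTLY from published theorems — so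
that the rank-`≤ 1` remainder becomes exactly the CONSTRUCTION-SHAPED classes, which are TYPED
(missing-input `Prop`s), NOT attempted.  This is not "finishing BSD".  Nothing here is booked; no
mark / label / count / tier moves.

WHAT THIS FILE DOES.  The generic-prime ENDs of this seat's Kolyvagin telescope on the
Kodaira–Néron sub-class AT `p` — `KolyvaginAssembly.sha_primary_finite_at_of_leafInputs_of_poitouTate_of_kodairaNeron`
(`KolyvaginShaFiniteAtPrime`, p323190: `Ш(E/K)[p^∞]` finite) and
`KolyvaginAnnihilator.pow_smul_sha_primary_eq_zero_at_of_leafInputs_of_poitouTate_of_kodairaNeron`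
(`KolyvaginShaAnnihilatorAtPrime`: `p^{m} · Ш(E/K)[p^∞] = 0` for `p^{m+1} ∤ y_K`) — are CONDITIONAL
on EXACTLY the five labelled cite-only inputs {`hPT`, `hrec`, `hCM`, `h53`, `hγ`} AT `p` + `hN` +
(KN_p).  FOUR of the five are now KERNEL THEOREMS of the tree (2026-08-27):
`hPT = GaloisCohomology.poitouTate_sum_localTatePairing_eq_zero_holds K`,
`hrec = heegnerPointOfConductor_one_galoisConj_holds N W K`, `hCM = KolyvaginLeaves.hCM_holds N W K p`,
`h53 = KolyvaginLeaves.h53_holds hN p` (`X11b/KolyvaginLeafInputsDischarged`).  THIS FILE re-issues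
both ENDs with those labels SUPPLIED — every other binder and the conclusion VERBATIM, proof = one
application of the parent — so that for `E/ℚ` globally minimal without CM at `N = N_E`, `K`
imaginary quadratic Heegner with `d_K ∉ {−3, −4}`, a non-torsion Heegner point `y_K`, `p` odd with
`ρ̄_{E,p}` onto and (KN_p) (`p ∤ ord_v Δ_min` at multiplicative `v`; `p ≠ 3` or no IV/IV* place),
the finiteness of `Ш(E/K)[p^∞]` and its annihilation by `p^{m}` rest on EXACTLY ONE cite-only input
AT `p`: `hγ` = Gross 1991 Prop. 3.7 (2) (the Eichler–Shimura congruence; not in the tree).  The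
`p = 3` class forms on X11b @ 3 ∩ (KN₃)/ℚ are `Three/KolyvaginShaThreeDischarged` /
`…RatDischarged` / `…OrderThreeDischarged`; the generic-`p` ORDER form is
`KolyvaginShaOrderAtPrimeDischarged`.  Nothing else is claimed; nothing booked.

## What is proved (namespace `Summit.BirchSwinnertonDyer.Rank1Residual.X11b.KolyvaginDischarged`)

* `sha_primary_finite_at_of_kodairaNeron` — `Ш(E/K)[p^∞]` finite at `p`, modulo {`hγ`} + `hN` + (KN_p).
* `pow_smul_sha_primary_eq_zero_at_of_kodairaNeron` — `p^{m+1} ∤ y_K ⟹ p^{m} · Ш(E/K)[p^∞] = 0`,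
  modulo {`hγ`} + `hN` + (KN_p).

## References

* [McCallumLMS1991] W. G. McCallum, *Kolyvagin's work on Shafarevich–Tate groups*, LMS LNS 153
  (1991), §1 Theorem (Kolyvagin), §2 Prop. 2.2, Lemma 5.1.
* [GrossLMS1991] B. H. Gross, *Kolyvagin's work on modular elliptic curves*, same volume, Thm. 1.3
  (2), §3 Prop. 3.7 (2), Prop. 5.3, Prop. 6.2 (1).
* [SilvermanAEC2009] Thm. VII.6.1; [GrossZagier1986] III (3.1); [Darmon2004] Thm. 3.6, Thm. 3.7.

presearch: `lean search 'X11b.KolyvaginDischarged'` → none; parents = the two tree ENDs named above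
(this seat, GEN 35/37); dischargers = tree theorems of 2026-08-27 (see
`X11b/KolyvaginLeafInputsDischarged`); [corpus:book:editornd-l-functions-arithmetic chunk 216
(Prop. 3.7)] for the remaining input; nothing minted.
-/

noncomputable section

open scoped Classical
open WeierstrassCurve Field NumberField IsDedekindDomain
open Literature.NumberTheory.EllipticCurves Literature.NumberTheory.GaloisRepresentations
open Literature.NumberTheory.EllipticCurves.RingClassField
open Literature.NumberTheory.EllipticCurves.ModularForms
open Literature.NumberTheory.DiophantineGeometry Literature.NumberTheory.DiophantineGeometry.TateAlgorithm
open Literature.NumberTheory.GaloisCohomology (poitouTate_sum_localTatePairing_eq_zero_holds)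
open Summit.BirchSwinnertonDyer.Rank1Residual.X11b.KolyvaginAssembly

namespace Summit.BirchSwinnertonDyer.Rank1Residual.X11b.KolyvaginDischarged

-- `K : Type`: the tree's ring-class class field theory is universe `0`.
variable {K : Type} [Field K] [NumberField K] {N : ℕ} {W : WeierstrassCurve ℚ}

/-- **`Ш(E/K)[p^∞]` finite at ONE odd surjective prime `p` on the Kodaira–Néron sub-class AT `p` —
modulo ONE cite-only input `hγ` AT `p`.**  The tree END
`KolyvaginAssembly.sha_primary_finite_at_of_leafInputs_of_poitouTate_of_kodairaNeron` (FIVE labels)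
with `hPT`, `hrec`, `hCM`, `h53` SUPPLIED by `poitouTate_sum_localTatePairing_eq_zero_holds K`,
`heegnerPointOfConductor_one_galoisConj_holds N W K`, `KolyvaginLeaves.hCM_holds N W K p`,
`KolyvaginLeaves.h53_holds hN p`; every other binder and the conclusion VERBATIM.  For `E = W/ℚ`
globally minimal, `¬ CM`, `N = N_E` (`hN`), `K` imaginary quadratic Heegner with `d_K ∉ {−3, −4}`,
`P` a non-torsion Heegner point, `p` odd with `ρ̄_{E,p}` onto, (KN_p) (`hKNm`, `hKNa`).
CONDITIONAL on EXACTLY {`hγ`} AT `p` (Gross Prop. 3.7 (2); cite-only, NOT discharged) + `hN` +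
(KN_p); nothing booked; no mark / count / tier moves.
[cite: McCallumLMS1991, §1 Theorem (Kolyvagin)] [cite: GrossLMS1991, Thm. 1.3 (2), §3 Prop. 3.7 (2), Prop. 6.2 (1)]
[cite: SilvermanAEC2009, Thm. VII.6.1] -/
theorem sha_primary_finite_at_of_kodairaNeron [NeZero N]
    [W.IsGloballyMinimal] {p : ℕ} (hp : p.Prime) (hp2 : p ≠ 2)
    (hN : ∀ [W.IsElliptic], N = W.conductorNorm ℤ)
    (hKNm : ∀ [W.IsElliptic] (v : HeightOneSpectrum (𝓞 K)),
      (W.baseChange K).HasMultiplicativeReductionAt v →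
        ¬ p ∣ (W.baseChange K).ordMinimalDiscriminant v)
    (hKNa : ∀ [W.IsElliptic] (v : HeightOneSpectrum (𝓞 K)),
      (W.baseChange K).HasAdditiveReductionAt v → p ≠ 3 ∨
        ((W.baseChange K).kodairaSymbolAt v ≠ KodairaSymbol.IV ∧
          (W.baseChange K).kodairaSymbolAt v ≠ KodairaSymbol.IVstar))
    (hγ : ∀ [W.IsElliptic] (_hK : IsImaginaryQuadratic K) (_hH : SatisfiesHeegnerHypothesis N K)
      (Dt : ModularParametrizationData W N) (β : ℤ) (ι : K →+* ℂ) {M : ℕ}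
      (_hM : 1 ≤ M) {n : ℕ} (_hn : Squarefree n)
      (_hKol : ∀ q ∈ n.primeFactors, IsKolyvaginPrime N W K p q ∧ FrobEqFrobInfty W K (p ^ M) q)
      (d : (m : ℕ) → m ∣ n → KolyvaginHeegnerData Dt β ι m)
      (m : ℕ) (hm : m ∣ n) (ℓ : ℕ) (hℓ : ℓ ∈ m.primeFactors) [Fact ℓ.Prime]
      (hΔ : ¬ (ℓ : ℤ) ∣ minimalDiscriminantInt W) (φ₀ : absoluteGaloisGroup (ZMod ℓ)),
      (∀ x : AlgebraicClosure (ZMod ℓ), φ₀ • x = x ^ ℓ) →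
      ∀ (hle : ringClassField K ι (m / ℓ) ≤ ringClassField K ι m)
        (γ : ringClassField K ι m ≃ₐ[ℚ] ringClassField K ι m), γ ∈ ringClassGal ι m →
        geomReduction hΔ ((RatClosure.pointsEquiv (K := K) W).symm
            ((d m hm).toGeomPoints (pointGalHom W (ringClassField K ι m) γ (d m hm).y))) =
          φ₀ • geomReduction hΔ ((RatClosure.pointsEquiv (K := K) W).symm
            ((d m hm).toGeomPoints (pointGalHom W (ringClassField K ι m) γ
              (WeierstrassCurve.Affine.Point.map (W' := W)
                ((RingClassField.inclusion ι hle).restrictScalars ℚ)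
                (d (m / ℓ)
                  ((Nat.div_dvd_of_dvd (Nat.dvd_of_mem_primeFactors hℓ)).trans hm)).y))))) :
    ∀ [W.IsElliptic] (_hE : ¬ W.HasCM) (_hK : IsImaginaryQuadratic K)
      (_hD : NumberField.discr K ≠ -3 ∧ NumberField.discr K ≠ -4)
      (_hH : SatisfiesHeegnerHypothesis N K)
      {P : (W.baseChange K).toAffine.Point} (_hP : IsHeegnerPoint N W K P)
      (_hnt : ¬ IsOfFinAddOrder P) (_hρ : W.HasSurjectiveModNGaloisRep p),
      Set.Finite {c : (W.baseChange K).sha | ∃ j : ℕ, p ^ j • c = 0} :=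
  KolyvaginAssembly.sha_primary_finite_at_of_leafInputs_of_poitouTate_of_kodairaNeron hp hp2
    (poitouTate_sum_localTatePairing_eq_zero_holds K) hN
    (heegnerPointOfConductor_one_galoisConj_holds N W K) (KolyvaginLeaves.hCM_holds N W K p)
    (@fun _ ↦ KolyvaginLeaves.h53_holds hN p) hKNm hKNa hγ

/-- **Kolyvagin's annihilator at ONE odd surjective prime `p` on the Kodaira–Néron sub-class AT
`p`: `p^{m+1} ∤ y_K ⟹ p^{m} · Ш(E/K)[p^∞] = 0` — modulo ONE cite-only input `hγ` AT `p`.**  The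
tree END `KolyvaginAnnihilator.pow_smul_sha_primary_eq_zero_at_of_leafInputs_of_poitouTate_of_kodairaNeron`
with `hPT`, `hrec`, `hCM`, `h53` SUPPLIED by the tree theorems; binders/conclusion otherwise
VERBATIM.  CONDITIONAL on EXACTLY {`hγ`} AT `p` + `hN` + (KN_p); nothing booked; no mark.
[cite: McCallumLMS1991, §1 Theorem (Kolyvagin), §2 Prop. 2.2, Lemma 5.1]
[cite: GrossLMS1991, Thm. 1.3 (2), §3 Prop. 3.7 (2), Prop. 6.2 (1)] [cite: SilvermanAEC2009, Thm. VII.6.1] -/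
theorem pow_smul_sha_primary_eq_zero_at_of_kodairaNeron [NeZero N]
    [W.IsGloballyMinimal] {p : ℕ} (hp : p.Prime) (hp2 : p ≠ 2)
    (hN : ∀ [W.IsElliptic], N = W.conductorNorm ℤ)
    (hKNm : ∀ [W.IsElliptic] (v : HeightOneSpectrum (𝓞 K)),
      (W.baseChange K).HasMultiplicativeReductionAt v →
        ¬ p ∣ (W.baseChange K).ordMinimalDiscriminant v)
    (hKNa : ∀ [W.IsElliptic] (v : HeightOneSpectrum (𝓞 K)),
      (W.baseChange K).HasAdditiveReductionAt v → p ≠ 3 ∨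
        ((W.baseChange K).kodairaSymbolAt v ≠ KodairaSymbol.IV ∧
          (W.baseChange K).kodairaSymbolAt v ≠ KodairaSymbol.IVstar))
    (hγ : ∀ [W.IsElliptic] (_hK : IsImaginaryQuadratic K) (_hH : SatisfiesHeegnerHypothesis N K)
      (Dt : ModularParametrizationData W N) (β : ℤ) (ι : K →+* ℂ) {M : ℕ}
      (_hM : 1 ≤ M) {n : ℕ} (_hn : Squarefree n)
      (_hKol : ∀ q ∈ n.primeFactors, IsKolyvaginPrime N W K p q ∧ FrobEqFrobInfty W K (p ^ M) q)
      (d : (m : ℕ) → m ∣ n → KolyvaginHeegnerData Dt β ι m)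
      (m : ℕ) (hm : m ∣ n) (ℓ : ℕ) (hℓ : ℓ ∈ m.primeFactors) [Fact ℓ.Prime]
      (hΔ : ¬ (ℓ : ℤ) ∣ minimalDiscriminantInt W) (φ₀ : absoluteGaloisGroup (ZMod ℓ)),
      (∀ x : AlgebraicClosure (ZMod ℓ), φ₀ • x = x ^ ℓ) →
      ∀ (hle : ringClassField K ι (m / ℓ) ≤ ringClassField K ι m)
        (γ : ringClassField K ι m ≃ₐ[ℚ] ringClassField K ι m), γ ∈ ringClassGal ι m →
        geomReduction hΔ ((RatClosure.pointsEquiv (K := K) W).symm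
            ((d m hm).toGeomPoints (pointGalHom W (ringClassField K ι m) γ (d m hm).y))) =
          φ₀ • geomReduction hΔ ((RatClosure.pointsEquiv (K := K) W).symm
            ((d m hm).toGeomPoints (pointGalHom W (ringClassField K ι m) γ
              (WeierstrassCurve.Affine.Point.map (W' := W)
                ((RingClassField.inclusion ι hle).restrictScalars ℚ)
                (d (m / ℓ)
                  ((Nat.div_dvd_of_dvd (Nat.dvd_of_mem_primeFactors hℓ)).trans hm)).y))))) :
    ∀ [W.IsElliptic] (_hE : ¬ W.HasCM) (_hK : IsImaginaryQuadratic K)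
      (_hD : NumberField.discr K ≠ -3 ∧ NumberField.discr K ≠ -4)
      (_hH : SatisfiesHeegnerHypothesis N K)
      {P : (W.baseChange K).toAffine.Point} (_hP : IsHeegnerPoint N W K P)
      (_hnt : ¬ IsOfFinAddOrder P) (_hρ : W.HasSurjectiveModNGaloisRep p) {m : ℕ}
      (_hm : ∀ Q : (W.baseChange K).toAffine.Point, p ^ (m + 1) • Q ≠ P) (c : (W.baseChange K).sha),
      (∃ j : ℕ, p ^ j • c = 0) → p ^ m • c = 0 :=
  KolyvaginAnnihilator.pow_smul_sha_primary_eq_zero_at_of_leafInputs_of_poitouTate_of_kodairaNeron hp hp2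
    (poitouTate_sum_localTatePairing_eq_zero_holds K) hN
    (heegnerPointOfConductor_one_galoisConj_holds N W K) (KolyvaginLeaves.hCM_holds N W K p)
    (@fun _ ↦ KolyvaginLeaves.h53_holds hN p) hKNm hKNa hγ

end Summit.BirchSwinnertonDyer.Rank1Residual.X11b.KolyvaginDischarged

end
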